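import Summits.QuantumFields.BalabanUV.T4Continuum.Support.NE3FrameGenLocal
import HarnessLib

/-!
# T⁴ programme, node NE3 — route Π, row Π-R (curved step), file Π-R-W6d: THE ℓ¹ LETTER (R4) OF THE EXACT CURVED RIGHT INVERSE —
# `dirL1 (rightInvW … φ) (periodBox (N·L^{k+1})) ≤ l1C(d,L)∕(1 − θ_loc) · (L^{k+1})^d∕L^{k+1} · dirL1 φ (periodBox N)`, k-FREE, N-FREE

NE3 (node U1b) formalisation swarm, leaf seat `b2b-balaban-t4-ne3-formalise-leaf-01` (gen 8); row Π-R-W, letter (R4) of ruling ρ-g25-1 (2) in the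
currency of the owner's file 4 (`NE3DecomposedRepOfShapes.decomposedRep_of_shapes`, hypothesis `hR4`): fine box `periodBox (N * L^(k+1))`, coarse box
`periodBox N`, weight `(L^{k+1})^d ∕ L^{k+1}`.  THE THREE PIECES (ℓ¹ twins of W6b's): (i) the lift, block by block (`NE3BlockLineAverage.sum_periodBox_blocks`,
`‖covLift M W Φ (y,μ)‖ ≤ liftC∕M·‖Φ(blk M y, μ)‖`); (ii) the covariant corrector in ℓ¹ from gen-6's POINTWISE energy bound
`NE3CovariantTentInterpolantEnergy.normSq_gaugeDir_tinterpW_le` by `‖c‖² ≤ a² + b² ≤ (a+b)²` (no square roots but `√Kt ≤ √ktC∕M`, W6a `kt_mul_sq_le`),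
summed block by block and shifted on the coarse torus, against W6b¹'s ℓ¹ frame bound `sum_norm_frameGen_le`; (iii) the solve in ℓ¹ (W6b⁰ `dirL1_solve_le`).
ENDs: **`dirL1_hatInvW_le`** (unsolved operator, generic periodic coarse field) and **`dirL1_rightInvW_le`** (R4).

CONTENT ([folklore]; 0 sorry; DATA defs `corr1C`, `l1C` — explicit): §1 a real-number letter; §2 the corrector pointwise in ℓ¹ form and summed; §3 the
lift in ℓ¹; §4 `dirL1_hatInvW_le`; §5 `dirL1_rightInvW_le`.

HONEST FRAMING.  Kinematics of OUR objects; constants explicit and crude; (R2),(R3),(R6′) (curl) are leaf-02-g8's files; nothing about minimisers; (P♮)_W,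
T-E_w and **NE3 are NOT proved**; spine PROVED 0∕9; finite T⁴ rung (B)+1 — NOT infinite volume, NOT mass gap, NOT `BetaPertH`, NOT Clay.  PLACEMENT:
`Summits/QuantumFields/BalabanUV/`.  HONEST DEPENDENCY (cell page 1): continuum YM on T⁴ ⇐ BetaPertH ∧ nine spine estimates (0/9 proved); BetaPertH ⇐
(D1) ∧ (D4) ∧ CAP+tail; G-an2-4 gates asym, D1 and NE2/3/4.
-/

set_option autoImplicit false

open scoped BigOperators Matrix.Norms.L2Operator
open Finset

namespace Summit.QuantumFields.BalabanUV.T4Continuum.NE3RightInverseL1Letter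

open Literature.MathematicalPhysics.QuantumFieldTheory.Balaban1983to89
open B7Prop1Explicit B7Prop2Explicit
open T4AveragingDeficitWall (IsUnitaryCfg IsSkewDir SmallField dirL1)
open T4AveragingDeficitWallBoundary (IsPeriodicCfg periodBox card_periodBox sum_periodBox_shift)
open AveragingDeficitPeriodicCounting (IsPeriodicDir)
open AveragingDeficitTransport (norm_Ad_of_unitary)
open AveragingDeficitMultiLevelPrep (cavgIter LevelSmall tower cavgIter_unitary_small isPeriodicCfg_cavgIter)
open AveragingDeficitTwoLevelPrep (prop1Radius skewSub)
open AveragingDeficitTorusChart (TDir extDir isPeriodicDir_extDir)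
open AveragingDeficitBlockDensity (bseg)
open SpreadLift (loopRad)
open BlockAveragePushDirGauge (gaugeDir)
open SmoothRefineBlocks (blk)
open SmoothRefineInterp (indic)
open NE3CoarseInterpolant (blk_block)
open NE3BlockLineAverage (sum_periodBox_blocks)
open NE3CovariantTentInterpolant (tinterpW)
open NE3CovariantTentInterpolantEnergy (normSq_gaugeDir_tinterpW_le)
open NE3TowerBondVsSegment (norm_cavgIter_sub_bseg_le_top)
open NE3SmoothLiftBounds (norm_smoothLift_le)
open NE3CovariantLift (covLift hatInvW frameGen norm_covLift_eq frameGen_add_period)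
open NE3QbarIterCovLiftPrep (liftC cruxC liftC_nonneg)
open NE3SmoothRightInverseW (solveW resSkew rightInvW)
open NE3RightInverseSupLetters (frameC ktC ktC_nonneg kt_mul_sq_le)
open NE3RightInverseSolveLetters (l1Ball card_l1Ball_le thetaLoc thetaLoc_nonneg dirL1_solve_le)
open NE3FrameGenLocal (frameRad sum_norm_frameGen_le)

noncomputable section

variable {d : ℕ} {n : Type*} [Fintype n] [DecidableEq n]

/-! ## §1 Two real-number letters -/

omit [Fintype n] [DecidableEq n] in
/-- From `c² ≤ A·Σf² + K·Σg²` to `c ≤ √A·Σf + √K·Σg` without square roots of sums: if `A ≤ a₀²`, `K ≤ k₀²` (`a₀, k₀ ≥ 0`), `f, g ≥ 0`, `c ≥ 0`, then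
`c ≤ a₀·Σf + k₀·Σg`. [folklore] -/
theorem le_of_sq_le_two_sums {ι : Type*} (s t : Finset ι) {f g : ι → ℝ} (hf : ∀ i ∈ s, 0 ≤ f i) (hg : ∀ i ∈ t, 0 ≤ g i)
    {c A K a₀ k₀ : ℝ} (hc : 0 ≤ c) (ha₀ : 0 ≤ a₀) (hk₀ : 0 ≤ k₀) (hA : A ≤ a₀ ^ 2) (hK : K ≤ k₀ ^ 2)
    (h : c ^ 2 ≤ A * ∑ i ∈ s, f i ^ 2 + K * ∑ i ∈ t, g i ^ 2) :
    c ≤ a₀ * ∑ i ∈ s, f i + k₀ * ∑ i ∈ t, g i := by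
  have hF0 : 0 ≤ ∑ i ∈ s, f i := Finset.sum_nonneg hf
  have hG0 : 0 ≤ ∑ i ∈ t, g i := Finset.sum_nonneg hg
  have hF2 : 0 ≤ ∑ i ∈ s, f i ^ 2 := Finset.sum_nonneg fun i _ => sq_nonneg _
  have hG2 : 0 ≤ ∑ i ∈ t, g i ^ 2 := Finset.sum_nonneg fun i _ => sq_nonneg _
  have h1 : A * ∑ i ∈ s, f i ^ 2 ≤ (a₀ * ∑ i ∈ s, f i) ^ 2 := by
    rw [mul_pow]; exact (mul_le_mul_of_nonneg_right hA hF2).trans (mul_le_mul_of_nonneg_left (Finset.sum_sq_le_sq_sum_of_nonneg hf) (sq_nonneg _))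
  have h2 : K * ∑ i ∈ t, g i ^ 2 ≤ (k₀ * ∑ i ∈ t, g i) ^ 2 := by
    rw [mul_pow]; exact (mul_le_mul_of_nonneg_right hK hG2).trans (mul_le_mul_of_nonneg_left (Finset.sum_sq_le_sq_sum_of_nonneg hg) (sq_nonneg _))
  have hab : 0 ≤ a₀ * ∑ i ∈ s, f i + k₀ * ∑ i ∈ t, g i := by positivity
  have hsq : c ^ 2 ≤ (a₀ * ∑ i ∈ s, f i + k₀ * ∑ i ∈ t, g i) ^ 2 := by
    nlinarith [mul_nonneg (mul_nonneg ha₀ hF0) (mul_nonneg hk₀ hG0)]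
  exact (pow_le_pow_iff_left₀ hc hab two_ne_zero).mp hsq

/-! ## §2 The covariant corrector in ℓ¹(fine torus) -/

/-- THE CORRECTOR ℓ¹ CONSTANT: `corr1C = d·2^d·(4 + √ktC)`. [folklore] -/
def corr1C (d : ℕ) : ℝ := d * (2 : ℝ) ^ d * (4 + Real.sqrt (ktC d))

/-- `0 ≤ corr1C`. [folklore] -/
theorem corr1C_nonneg (d : ℕ) : 0 ≤ corr1C d := by unfold corr1C; positivity

/-- **ℓ¹ OF A GAUGE DIRECTION** (unitary `U`, `N`-periodic generator `m`): `Σ_{z∈periodBox N} Σ_α ‖gaugeDir U m z α‖ ≤ 2d·Σ_{z∈periodBox N} ‖m z‖`. [folklore] -/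
theorem sum_norm_gaugeDir_le {U : Site d → Fin d → (Matrix n n ℂ)ˣ} (hU : IsUnitaryCfg U) {N : ℕ} (hN : 1 ≤ N)
    {m : Site d → Matrix n n ℂ} (hm : ∀ (z : Site d) (τ : Fin d), m (z + (N : ℤ) • e τ) = m z) :
    ∑ z ∈ periodBox (d := d) N, ∑ α : Fin d, ‖gaugeDir U m z α‖ ≤ 2 * d * ∑ z ∈ periodBox (d := d) N, ‖m z‖ := by
  have hpt : ∀ (z : Site d) (α : Fin d), ‖gaugeDir U m z α‖ ≤ ‖m z‖ + ‖m (z + e α)‖ := by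
    intro z α
    unfold gaugeDir
    refine (norm_sub_le _ _).trans ?_
    rw [norm_Ad_of_unitary ((unitaryUnits _).inv_mem (hU z α))]
  calc ∑ z ∈ periodBox (d := d) N, ∑ α : Fin d, ‖gaugeDir U m z α‖
      ≤ ∑ z ∈ periodBox (d := d) N, ∑ α : Fin d, (‖m z‖ + ‖m (z + e α)‖) := Finset.sum_le_sum fun z _ => Finset.sum_le_sum fun α _ => hpt z α
    _ = ∑ α : Fin d, (∑ z ∈ periodBox (d := d) N, ‖m z‖ + ∑ z ∈ periodBox (d := d) N, ‖m (z + e α)‖) := by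
        rw [Finset.sum_comm]; exact Finset.sum_congr rfl fun α _ => Finset.sum_add_distrib
    _ = ∑ _α : Fin d, 2 * ∑ z ∈ periodBox (d := d) N, ‖m z‖ := by
        refine Finset.sum_congr rfl fun α _ => ?_
        rw [sum_periodBox_shift N hN (g := fun w => ‖m w‖) (fun w τ => by simp only [hm w τ]) (e α)]; ring
    _ = 2 * d * ∑ z ∈ periodBox (d := d) N, ‖m z‖ := by rw [Finset.sum_const, Finset.card_univ, Fintype.card_fin, nsmul_eq_mul]; ring

/-- **THE COVARIANT CORRECTOR IN ℓ¹** (`L ≥ 2`, class, `W` of period `L^{k+1}·N`, regime `(L^{k+1})²x ≤ 1`, `N`-periodic generator `m`):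
`Σ_{y∈periodBox(M·N)} Σ_α ‖gaugeDir W (tinterpW M W m) y α‖ ≤ corr1C·(M^d∕M)·Σ_{z∈periodBox N}‖m z‖`, `M = L^{k+1}`. [folklore] -/
theorem sum_norm_corrector_le [Nonempty n] {L : ℕ} (hL : 2 ≤ L) (k : ℕ) {N : ℕ} [NeZero N] {W : Site d → Fin d → (Matrix n n ℂ)ˣ} {x : ℝ}
    (hWu : IsUnitaryCfg W) (hWP : IsPeriodicCfg W ((tower L N (k + 1) : ℕ) : ℤ)) (hx : 0 ≤ x) (hs : LevelSmall d L k x) (hWx : SmallField W x)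
    (hε : ((L : ℝ) ^ (k + 1)) ^ 2 * x ≤ 1) {m : Site d → Matrix n n ℂ} (hm : ∀ (z : Site d) (τ : Fin d), m (z + (N : ℤ) • e τ) = m z) :
    ∑ y ∈ periodBox (d := d) (L ^ (k + 1) * N), ∑ α : Fin d, ‖gaugeDir W (tinterpW (L ^ (k + 1)) W m) y α‖
      ≤ corr1C d * (((L : ℝ) ^ (k + 1)) ^ d / (L : ℝ) ^ (k + 1)) * ∑ z ∈ periodBox (d := d) N, ‖m z‖ := by
  have hL1 : 1 ≤ L := by omega
  have hN1 : 1 ≤ N := Nat.one_le_iff_ne_zero.mpr (NeZero.ne N)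
  obtain ⟨M, hM⟩ : ∃ M : ℕ, M = L ^ (k + 1) := ⟨_, rfl⟩
  have hM1 : 1 ≤ M := by rw [hM]; exact Nat.one_le_pow _ _ (by omega)
  have hMr : ((M : ℕ) : ℝ) = (L : ℝ) ^ (k + 1) := by rw [hM]; push_cast; ring
  have hM0 : (0 : ℝ) < (M : ℝ) := by exact_mod_cast (show 0 < M by omega)
  rw [← hM, ← hMr]
  obtain ⟨hUu, -, -⟩ := cavgIter_unitary_small hL1 k hWu hx hs hWx
  have hUP : IsPeriodicCfg (cavgIter L (k + 1) W) (N : ℤ) := isPeriodicCfg_cavgIter L N (k + 1) hWP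
  have hδb : ∀ (w : Site d) (β : Fin d), ‖((cavgIter L (k + 1) W w β : (Matrix n n ℂ)ˣ) : Matrix n n ℂ) - bseg M W w β‖
      ≤ 8 * loopRad d L ((prop1Radius d L)^[k] x) := fun w β => by
    rw [hM]; exact norm_cavgIter_sub_bseg_le_top hL k hWu hx hs hWx w β
  have hkt := kt_mul_sq_le (d := d) hL k hx hs hMr hε
  obtain ⟨Kt, hKt⟩ : ∃ K' : ℝ, K' = 8 * ((d : ℝ) * M * x) ^ 2
      + (16 / (M : ℝ) ^ 2) * (8 * loopRad d L ((prop1Radius d L)^[k] x) + 9 * (d : ℝ) ^ 2 * (M : ℝ) ^ 2 * x) ^ 2 := ⟨_, rfl⟩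
  rw [← hKt] at hkt
  have hK0 : 0 ≤ Kt := by rw [hKt]; positivity
  -- `√Kt ≤ √ktC ∕ M`
  have hsK : Real.sqrt Kt ≤ Real.sqrt (ktC d) / M := by
    rw [le_div_iff₀ hM0, ← Real.sqrt_sq hM0.le, ← Real.sqrt_mul hK0]
    exact Real.sqrt_le_sqrt hkt
  -- pointwise ℓ¹ form of gen-6's energy bound
  set U := cavgIter L (k + 1) W with hU
  have hpt : ∀ (y : Site d) (α : Fin d), ‖gaugeDir W (tinterpW M W m) y α‖
      ≤ (2 / (M : ℝ)) * ∑ T ∈ (Finset.univ.erase α).powerset, ‖gaugeDir U m (blk M y + indic T) α‖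
        + Real.sqrt Kt * ∑ T ∈ (Finset.univ : Finset (Fin d)).powerset, ‖m (blk M y + indic T)‖ := by
    intro y α
    have h := normSq_gaugeDir_tinterpW_le hM1 hWu hUu hx hWx hδb m y α
    rw [← hKt] at h
    refine le_of_sq_le_two_sums _ _ (fun _ _ => norm_nonneg _) (fun _ _ => norm_nonneg _) (norm_nonneg _) (by positivity)
      (Real.sqrt_nonneg _) (le_of_eq ?_) (le_of_eq (Real.sq_sqrt hK0).symm) h
    rw [div_pow]; norm_num
  -- block by block, then shift invariance on the coarse torus
  have hperD : ∀ (α : Fin d) (w : Site d) (κ : Fin d), ‖gaugeDir U m (w + (N : ℤ) • e κ) α‖ = ‖gaugeDir U m w α‖ := by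
    intro α w κ
    simp only [gaugeDir]
    rw [hUP w κ α, add_right_comm, hm, hm]
  have hshiftD : ∀ (α : Fin d) (T : Finset (Fin d)),
      ∑ z ∈ periodBox (d := d) N, ‖gaugeDir U m (z + indic T) α‖ = ∑ z ∈ periodBox (d := d) N, ‖gaugeDir U m z α‖ :=
    fun α T => sum_periodBox_shift N hN1 (g := fun z => ‖gaugeDir U m z α‖) (hperD α) (indic T)
  have hshiftM : ∀ T : Finset (Fin d), ∑ z ∈ periodBox (d := d) N, ‖m (z + indic T)‖ = ∑ z ∈ periodBox (d := d) N, ‖m z‖ :=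
    fun T => sum_periodBox_shift N hN1 (g := fun z => ‖m z‖) (fun w κ => by simp only [hm]) (indic T)
  set S1 : ℝ := ∑ z ∈ periodBox (d := d) N, ‖m z‖ with hS1
  have hS10 : 0 ≤ S1 := Finset.sum_nonneg fun _ _ => norm_nonneg _
  have hG1 := sum_norm_gaugeDir_le hUu hN1 hm
  have hcardE : ∀ α : Fin d, ((((Finset.univ : Finset (Fin d)).erase α).powerset.card : ℝ)) ≤ (2 : ℝ) ^ d := by
    intro α
    rw [Finset.card_powerset, Finset.card_erase_of_mem (Finset.mem_univ α), Finset.card_univ, Fintype.card_fin]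
    exact_mod_cast Nat.pow_le_pow_right (by norm_num) (Nat.sub_le d 1)
  have hcardU : (((Finset.univ : Finset (Fin d)).powerset.card : ℝ)) = (2 : ℝ) ^ d := by
    rw [Finset.card_powerset, Finset.card_univ, Fintype.card_fin]; push_cast; ring
  -- the coarse `z`-sum of the pointwise majorant
  have hinner : ∑ z ∈ periodBox (d := d) N, ∑ α : Fin d,
      ((2 / (M : ℝ)) * ∑ T ∈ (Finset.univ.erase α).powerset, ‖gaugeDir U m (z + indic T) α‖
        + Real.sqrt Kt * ∑ T ∈ (Finset.univ : Finset (Fin d)).powerset, ‖m (z + indic T)‖)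
      ≤ (2 / (M : ℝ)) * (2 : ℝ) ^ d * (2 * d * S1) + d * (Real.sqrt Kt * ((2 : ℝ) ^ d * S1)) := by
    rw [Finset.sum_comm]
    have hα : ∀ α : Fin d, ∑ z ∈ periodBox (d := d) N,
        ((2 / (M : ℝ)) * ∑ T ∈ (Finset.univ.erase α).powerset, ‖gaugeDir U m (z + indic T) α‖
          + Real.sqrt Kt * ∑ T ∈ (Finset.univ : Finset (Fin d)).powerset, ‖m (z + indic T)‖)
        ≤ (2 / (M : ℝ)) * ((2 : ℝ) ^ d * ∑ z ∈ periodBox (d := d) N, ‖gaugeDir U m z α‖) + Real.sqrt Kt * ((2 : ℝ) ^ d * S1) := by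
      intro α
      rw [Finset.sum_add_distrib, ← Finset.mul_sum, ← Finset.mul_sum, Finset.sum_comm, Finset.sum_congr rfl fun T _ => hshiftD α T,
        Finset.sum_const, nsmul_eq_mul, Finset.sum_comm, Finset.sum_congr rfl fun T _ => hshiftM T, Finset.sum_const, nsmul_eq_mul, hcardU]
      have hz0 : 0 ≤ ∑ z ∈ periodBox (d := d) N, ‖gaugeDir U m z α‖ := Finset.sum_nonneg fun _ _ => norm_nonneg _
      have := mul_le_mul_of_nonneg_right (hcardE α) hz0
      have h2M : 0 ≤ 2 / (M : ℝ) := by positivity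
      nlinarith [mul_le_mul_of_nonneg_left this h2M]
    refine (Finset.sum_le_sum fun α _ => hα α).trans ?_
    rw [Finset.sum_add_distrib, Finset.sum_const, Finset.card_univ, Fintype.card_fin, nsmul_eq_mul, ← Finset.mul_sum]
    have hsum : ∑ α : Fin d, (2 : ℝ) ^ d * ∑ z ∈ periodBox (d := d) N, ‖gaugeDir U m z α‖
        = (2 : ℝ) ^ d * ∑ z ∈ periodBox (d := d) N, ∑ α : Fin d, ‖gaugeDir U m z α‖ := by rw [← Finset.mul_sum, Finset.sum_comm]
    rw [hsum]
    have h2M : 0 ≤ 2 / (M : ℝ) * (2 : ℝ) ^ d := by positivity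
    nlinarith [mul_le_mul_of_nonneg_left hG1 h2M]
  calc ∑ y ∈ periodBox (d := d) (M * N), ∑ α : Fin d, ‖gaugeDir W (tinterpW M W m) y α‖
      ≤ ∑ y ∈ periodBox (d := d) (M * N), ∑ α : Fin d,
          ((2 / (M : ℝ)) * ∑ T ∈ (Finset.univ.erase α).powerset, ‖gaugeDir U m (blk M y + indic T) α‖
            + Real.sqrt Kt * ∑ T ∈ (Finset.univ : Finset (Fin d)).powerset, ‖m (blk M y + indic T)‖) :=
        Finset.sum_le_sum fun y _ => Finset.sum_le_sum fun α _ => hpt y α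
    _ = (M : ℝ) ^ d * ∑ z ∈ periodBox (d := d) N, ∑ α : Fin d,
          ((2 / (M : ℝ)) * ∑ T ∈ (Finset.univ.erase α).powerset, ‖gaugeDir U m (z + indic T) α‖
            + Real.sqrt Kt * ∑ T ∈ (Finset.univ : Finset (Fin d)).powerset, ‖m (z + indic T)‖) := by
        rw [← sum_periodBox_blocks M N hM1, Finset.mul_sum]
        refine Finset.sum_congr rfl fun z _ => ?_
        rw [Finset.sum_congr rfl fun v hv => by rw [blk_block hM1 z hv], Finset.sum_const, card_periodBox, nsmul_eq_mul, Nat.cast_pow]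
    _ ≤ (M : ℝ) ^ d * ((2 / (M : ℝ)) * (2 : ℝ) ^ d * (2 * d * S1) + d * (Real.sqrt Kt * ((2 : ℝ) ^ d * S1))) :=
        mul_le_mul_of_nonneg_left hinner (by positivity)
    _ ≤ (M : ℝ) ^ d * ((2 / (M : ℝ)) * (2 : ℝ) ^ d * (2 * d * S1) + d * (Real.sqrt (ktC d) / M * ((2 : ℝ) ^ d * S1))) := by
        have h := mul_le_mul_of_nonneg_right hsK (show 0 ≤ (2 : ℝ) ^ d * S1 by positivity)
        have hMd : 0 ≤ (M : ℝ) ^ d := by positivity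
        nlinarith [mul_le_mul_of_nonneg_left (mul_le_mul_of_nonneg_left h (Nat.cast_nonneg d)) hMd]
    _ = corr1C d * ((M : ℝ) ^ d / (M : ℝ)) * S1 := by rw [corr1C]; field_simp; ring

/-! ## §3 The transported lift in ℓ¹(fine torus) -/

/-- **THE LIFT IN ℓ¹**: `dirL1 (covLift M W Φ) (periodBox (M·N)) ≤ liftC·(M^d∕M)·dirL1 Φ (periodBox N)` (`M ≥ 2`, unitary `W`, `d ≥ 1`). [folklore] -/
theorem dirL1_covLift_le {M : ℕ} (hM : 2 ≤ M) (hd : 1 ≤ d) {W : Site d → Fin d → (Matrix n n ℂ)ˣ} (hWu : IsUnitaryCfg W) (N : ℕ)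
    (Φ : Site d → Fin d → Matrix n n ℂ) :
    dirL1 (covLift M W Φ) (periodBox (d := d) (M * N)) ≤ liftC d * ((M : ℝ) ^ d / (M : ℝ)) * dirL1 Φ (periodBox (d := d) N) := by
  have hM1 : 1 ≤ M := by omega
  have hM0 : (0 : ℝ) < (M : ℝ) := by exact_mod_cast (show 0 < M by omega)
  unfold dirL1
  have hpt : ∀ (y : Site d) (μ : Fin d), ‖covLift M W Φ y μ‖ ≤ liftC d / M * ‖Φ (blk M y) μ‖ := by
    intro y μ; rw [norm_covLift_eq hWu, liftC]; exact norm_smoothLift_le hM hd Φ y μ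
  calc ∑ y ∈ periodBox (d := d) (M * N), ∑ μ : Fin d, ‖covLift M W Φ y μ‖
      ≤ ∑ y ∈ periodBox (d := d) (M * N), ∑ μ : Fin d, liftC d / M * ‖Φ (blk M y) μ‖ :=
        Finset.sum_le_sum fun y _ => Finset.sum_le_sum fun μ _ => hpt y μ
    _ = (M : ℝ) ^ d * ∑ z ∈ periodBox (d := d) N, ∑ μ : Fin d, liftC d / M * ‖Φ z μ‖ := by
        rw [← sum_periodBox_blocks M N hM1, Finset.mul_sum]
        refine Finset.sum_congr rfl fun z _ => ?_
        rw [Finset.sum_congr rfl fun v hv => by rw [blk_block hM1 z hv], Finset.sum_const, card_periodBox, nsmul_eq_mul, Nat.cast_pow]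
    _ = liftC d * ((M : ℝ) ^ d / (M : ℝ)) * ∑ z ∈ periodBox (d := d) N, ∑ μ : Fin d, ‖Φ z μ‖ := by
        rw [Finset.mul_sum, Finset.mul_sum]
        refine Finset.sum_congr rfl fun z _ => ?_
        rw [Finset.mul_sum, Finset.mul_sum]
        exact Finset.sum_congr rfl fun μ _ => by ring

/-! ## §4 (R4) for the unsolved operator `hatInvW` -/

/-- THE ℓ¹ CONSTANT: `l1C = liftC + corr1C·frameC·liftC·(2·frameRad + 1)^d`. [folklore] -/
def l1C (d L : ℕ) : ℝ := liftC d + corr1C d * (frameC d L * liftC d) * (2 * (frameRad d L : ℝ) + 1) ^ d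

/-- `0 ≤ l1C`. [folklore] -/
theorem l1C_nonneg (d L : ℕ) : 0 ≤ l1C d L := by
  unfold l1C frameC; have := liftC_nonneg d; have := corr1C_nonneg d; positivity

/-- **(R4) FOR `hatInvW`** (`L ≥ 2`, class, `W` of period `L^{k+1}·N`, regime `(L^{k+1})²x ≤ 1`, `Φ` `N`-periodic):
`dirL1 (hatInvW L k W Φ) (periodBox (N·L^{k+1})) ≤ l1C·((L^{k+1})^d∕L^{k+1})·dirL1 Φ (periodBox N)`. [folklore] -/
theorem dirL1_hatInvW_le [Nonempty n] {L : ℕ} (hL : 2 ≤ L) (k : ℕ) {N : ℕ} [NeZero N] {W : Site d → Fin d → (Matrix n n ℂ)ˣ} {x : ℝ}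
    (hWu : IsUnitaryCfg W) (hWP : IsPeriodicCfg W ((tower L N (k + 1) : ℕ) : ℤ)) (hx : 0 ≤ x) (hs : LevelSmall d L k x) (hWx : SmallField W x)
    (hε : ((L : ℝ) ^ (k + 1)) ^ 2 * x ≤ 1) {Φ : Site d → Fin d → Matrix n n ℂ} (hΦP : IsPeriodicDir Φ (N : ℤ)) :
    dirL1 (hatInvW L k W Φ) (periodBox (d := d) (N * L ^ (k + 1)))
      ≤ l1C d L * (((L : ℝ) ^ (k + 1)) ^ d / (L : ℝ) ^ (k + 1)) * dirL1 Φ (periodBox (d := d) N) := by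
  rcases Nat.eq_zero_or_pos d with hd0 | hd
  · subst hd0
    simp only [dirL1, Finset.univ_eq_empty, Finset.sum_empty, Finset.sum_const_zero, mul_zero, le_refl]
  have hN1 : 1 ≤ N := Nat.one_le_iff_ne_zero.mpr (NeZero.ne N)
  obtain ⟨M, hM⟩ : ∃ M : ℕ, M = L ^ (k + 1) := ⟨_, rfl⟩
  have hM2 : 2 ≤ M := by
    rw [hM]; calc 2 ≤ L := hL
      _ = L ^ 1 := (pow_one L).symm
      _ ≤ L ^ (k + 1) := Nat.pow_le_pow_right (by omega) (by omega)
  have hMr : ((M : ℕ) : ℝ) = (L : ℝ) ^ (k + 1) := by rw [hM]; push_cast; ring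
  have hm : ∀ (z : Site d) (τ : Fin d), (fun w => -frameGen L k W Φ w) (z + (N : ℤ) • e τ) = (fun w => -frameGen L k W Φ w) z := by
    intro z τ; simp only [frameGen_add_period hL k hWP hΦP z τ]
  have hlift := dirL1_covLift_le hM2 hd hWu N Φ
  have hcorr := sum_norm_corrector_le hL k hWu hWP hx hs hWx hε (m := fun w => -frameGen L k W Φ w) hm
  have hG := sum_norm_frameGen_le hL k hWu hx hs hWx hN1 hΦP
  rw [← hM, ← hMr] at hcorr
  rw [← hMr, Nat.mul_comm N, ← hM]
  have hMd : 0 ≤ (M : ℝ) ^ d / (M : ℝ) := by positivity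
  have hD0 : 0 ≤ dirL1 Φ (periodBox (d := d) N) := by unfold dirL1; positivity
  have hcard : (((l1Ball (frameRad d L) : Finset (Site d))).card : ℝ) ≤ (2 * (frameRad d L : ℝ) + 1) ^ d := by
    exact_mod_cast card_l1Ball_le (d := d) (frameRad d L)
  have hsplit : dirL1 (hatInvW L k W Φ) (periodBox (d := d) (M * N))
      ≤ dirL1 (covLift M W Φ) (periodBox (d := d) (M * N))
        + ∑ y ∈ periodBox (d := d) (M * N), ∑ α : Fin d, ‖gaugeDir W (tinterpW M W fun w => -frameGen L k W Φ w) y α‖ := by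
    unfold dirL1
    rw [← Finset.sum_add_distrib]
    refine Finset.sum_le_sum fun y _ => ?_
    rw [← Finset.sum_add_distrib]
    refine Finset.sum_le_sum fun α _ => ?_
    have h := norm_add_le (covLift M W Φ y α) (gaugeDir W (tinterpW M W fun w => -frameGen L k W Φ w) y α)
    simpa only [hatInvW, hM] using h
  have hneg : ∑ z ∈ periodBox (d := d) N, ‖(fun w => -frameGen L k W Φ w) z‖ = ∑ z ∈ periodBox (d := d) N, ‖frameGen L k W Φ z‖ := by
    simp only [norm_neg]
  rw [hneg] at hcorr
  calc dirL1 (hatInvW L k W Φ) (periodBox (d := d) (M * N))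
      ≤ liftC d * ((M : ℝ) ^ d / (M : ℝ)) * dirL1 Φ (periodBox (d := d) N)
        + corr1C d * ((M : ℝ) ^ d / (M : ℝ))
            * (frameC d L * liftC d * ((l1Ball (frameRad d L) : Finset (Site d))).card * dirL1 Φ (periodBox (d := d) N)) := by
        refine hsplit.trans (add_le_add hlift ?_)
        exact hcorr.trans (mul_le_mul_of_nonneg_left hG (mul_nonneg (corr1C_nonneg d) hMd))
    _ ≤ l1C d L * ((M : ℝ) ^ d / (M : ℝ)) * dirL1 Φ (periodBox (d := d) N) := by
        rw [l1C]
        have hc1 := corr1C_nonneg d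
        have hfl : 0 ≤ frameC d L * liftC d := by unfold frameC; have := liftC_nonneg d; positivity
        have key : corr1C d * ((M : ℝ) ^ d / (M : ℝ)) * (frameC d L * liftC d * ((l1Ball (frameRad d L) : Finset (Site d))).card
              * dirL1 Φ (periodBox (d := d) N))
            ≤ corr1C d * ((M : ℝ) ^ d / (M : ℝ)) * (frameC d L * liftC d * (2 * (frameRad d L : ℝ) + 1) ^ d * dirL1 Φ (periodBox (d := d) N)) :=
          mul_le_mul_of_nonneg_left (mul_le_mul_of_nonneg_right (mul_le_mul_of_nonneg_left hcard hfl) hD0) (mul_nonneg hc1 hMd)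
        nlinarith [key]

/-! ## §5 (R4) for the exact right inverse -/

/-- **THE ℓ¹ LETTER (R4) OF THE EXACT CURVED RIGHT INVERSE** (`L ≥ 2`, class, `W` of period `L^{k+1}·N`, `θ = cruxC·ε < 1`, `θ_loc = thetaLoc·ε < 1`,
regime `ε = (L^{k+1})²x ≤ 1`, `φ` skew):
`dirL1 (rightInvW … φ) (periodBox (N·L^{k+1})) ≤ (l1C ∕ (1 − θ_loc))·((L^{k+1})^d∕L^{k+1})·dirL1 φ (periodBox N)`. [folklore] -/
theorem dirL1_rightInvW_le [Nonempty n] {L : ℕ} (hL : 2 ≤ L) (k : ℕ) {N : ℕ} [NeZero N] {W : Site d → Fin d → (Matrix n n ℂ)ˣ} {x : ℝ}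
    (hWu : IsUnitaryCfg W) (hWP : IsPeriodicCfg W ((tower L N (k + 1) : ℕ) : ℤ)) (hx : 0 ≤ x) (hs : LevelSmall d L k x) (hWx : SmallField W x)
    (hθ : cruxC d L * (((L : ℝ) ^ (k + 1)) ^ 2 * x) < 1) (hθl : thetaLoc d L * (((L : ℝ) ^ (k + 1)) ^ 2 * x) < 1)
    (hε : ((L : ℝ) ^ (k + 1)) ^ 2 * x ≤ 1) {φ : Site d → Fin d → Matrix n n ℂ} (hφ : IsSkewDir φ) :
    dirL1 (rightInvW hL k hWu hx hs hWx N hθ hφ) (periodBox (d := d) (N * L ^ (k + 1)))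
      ≤ (l1C d L / (1 - thetaLoc d L * (((L : ℝ) ^ (k + 1)) ^ 2 * x))) * (((L : ℝ) ^ (k + 1)) ^ d / (L : ℝ) ^ (k + 1))
          * dirL1 φ (periodBox (d := d) N) := by
  set Φ : Site d → Fin d → Matrix n n ℂ := extDir N ((solveW hL k hWu hx hs hWx N hθ (resSkew N hφ) : ↥(skewSub d n N)) : TDir d n N) with hΦ
  have hΦP : IsPeriodicDir Φ (N : ℤ) := isPeriodicDir_extDir N _
  have h1 := dirL1_hatInvW_le hL k hWu hWP hx hs hWx hε hΦP
  have h2 := dirL1_solve_le hL k hWu hx hs hWx N hθ hθl hφ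
  have hpos : 0 < 1 - thetaLoc d L * (((L : ℝ) ^ (k + 1)) ^ 2 * x) := by linarith
  have hval : rightInvW hL k hWu hx hs hWx N hθ hφ = hatInvW L k W Φ := rfl
  rw [hval]
  refine h1.trans ?_
  have hc : 0 ≤ l1C d L * (((L : ℝ) ^ (k + 1)) ^ d / (L : ℝ) ^ (k + 1)) := by have := l1C_nonneg d L; positivity
  calc l1C d L * (((L : ℝ) ^ (k + 1)) ^ d / (L : ℝ) ^ (k + 1)) * dirL1 Φ (periodBox (d := d) N)
      ≤ l1C d L * (((L : ℝ) ^ (k + 1)) ^ d / (L : ℝ) ^ (k + 1))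
          * (dirL1 φ (periodBox (d := d) N) / (1 - thetaLoc d L * (((L : ℝ) ^ (k + 1)) ^ 2 * x))) := mul_le_mul_of_nonneg_left h2 hc
    _ = (l1C d L / (1 - thetaLoc d L * (((L : ℝ) ^ (k + 1)) ^ 2 * x))) * (((L : ℝ) ^ (k + 1)) ^ d / (L : ℝ) ^ (k + 1))
          * dirL1 φ (periodBox (d := d) N) := by
        field_simp

end

end Summit.QuantumFields.BalabanUV.T4Continuum.NE3RightInverseL1Letter
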